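import Summits.ResolutionOfSingularities.ResolutionOfSingularities.Theorems.FrobeniusClosingSteerBetaGlueSupport
import HarnessLib

/-!
# Crux `Steer` (stmt-ResolutionOfSingularities-16345), chain W4.1, β-LEAF, K-β2♭ part (III), file G3: the WEIGHT FILTRATION of the
# near-point region and the PURIFICATION of a prepared representative (def-free)

OURS (campaign `res-hironaka`, rung L ★L-G4, slot W4.1; statements about the route's own objects; they replace the
role of no printed item and are NOT statements of the manuscript under review [claim: Hironaka2017, status:
under-review]; AI review is weaker than expert review). Seat res-D-pv-003 (gen 7), K-β2♭ owner; GLUE (III) per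
res-L0-w41-plan-1 RULING 276(a); FINDING J5-a.

The near-point region of the `y`-chart origin is the weight condition `W(e) = 2e₀ + e₁ + 2e₂ + 2e₃ ≥ 2d` (weights `(1, ½, 1, 1)`); its
monomial ideals `F_n(t) = (t^e : n ≤ W(e))` form a multiplicative filtration, stable under frame changes `z = z′ + δ₁`, `w = w′ + δ₂` with
`δᵢ ∈ F₂(t′)` (`span_uPow_weight_le_of_frame`). PURIFICATION (`exists_purified`): if `f ∈ F_(2d)` and a cleaning `f + u q²` satisfies
`BetaGe (α, β)`, then dropping from `q` the terms whose twisted squares leave `F_(2d)` gives a cleaning `f + u q′²` which satisfies `BetaGe (α, β)`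
AND lies in `F_(2d)`; moreover `f + u q′² = (f + u q²) + u r²` (characteristic `2`), so strictness and dissolvability are unchanged. Finally
`twistedSq_mem_coneCorrection`: a twisted square of order `≥ d` with `(z, w)`-free twist lies in `(x, y)𝔪^(d−1) + 𝔪^(d+1)` for ODD `d`.

[cite: CossartJannsenSaito2020, Lemma 12.2] [cite: CossartPiltant2019, Prop. 2.1] No Theses file is imported; nothing here is a route
item or a registration.
-/

noncomputable section

-- `Summit.<S>.<S>.…` duplicates the summit name by design (single-problem summit).
set_option linter.dupNamespace false

namespace Summit.ResolutionOfSingularities.ResolutionOfSingularities.Theorems.SwitchingDichotomy.BetaNewton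

open IsLocalRing
open Literature.AlgebraicGeometry.Resolution
open Literature.AlgebraicGeometry.Resolution.CossartPiltant (uPow uPow_mem_span_uPow uPow_mem_span_uPow_of_le minExponents
  uPow_add uPow_single exists_expansion_minExponents coeff_not_mem_of_minimal)
open Summit.ResolutionOfSingularities.ResolutionOfSingularities.Theorems.SwitchingDichotomy.BetaPolygon
open Summit.ResolutionOfSingularities.ResolutionOfSingularities.Theorems.SwitchingDichotomy.BetaLetter
  (uPow_four range_four span_four_pow_eq_span_uPow ceil_mul_mono floor_mul_mono)

variable {S : Type} [CommRing S]

/-! ## §1 The weight filtration `F_n(t) = (t^e : n ≤ 2e₀ + e₁ + 2e₂ + 2e₃)` -/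

/-- The weight ideals are multiplicative. [folklore] -/
theorem weightIdeal_mul_le (t : Fin 4 → S) (a b : ℕ) :
    Ideal.span (uPow t '' {e | a ≤ 2 * e 0 + e 1 + 2 * e 2 + 2 * e 3}) *
        Ideal.span (uPow t '' {e | b ≤ 2 * e 0 + e 1 + 2 * e 2 + 2 * e 3}) ≤
      Ideal.span (uPow t '' {e | a + b ≤ 2 * e 0 + e 1 + 2 * e 2 + 2 * e 3}) := by
  rw [Ideal.span_mul_span', Ideal.span_le]
  rintro _ ⟨_, ⟨e, he, rfl⟩, _, ⟨e', he', rfl⟩, rfl⟩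
  simp only [Set.mem_setOf_eq] at he he'
  show uPow t e * uPow t e' ∈ _
  rw [← uPow_add]
  refine uPow_mem_span_uPow t ?_
  simp only [Set.mem_setOf_eq, Pi.add_apply]
  omega

/-- The weight ideals decrease. [folklore] -/
theorem weightIdeal_anti (t : Fin 4 → S) {a b : ℕ} (h : a ≤ b) :
    Ideal.span (uPow t '' {e | b ≤ 2 * e 0 + e 1 + 2 * e 2 + 2 * e 3}) ≤
      Ideal.span (uPow t '' {e | a ≤ 2 * e 0 + e 1 + 2 * e 2 + 2 * e 3}) :=
  Ideal.span_mono (Set.image_mono fun _ (he : b ≤ _) => le_trans h he)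

/-- Powers climb the weight filtration. [folklore] -/
theorem pow_mem_weightIdeal (t : Fin 4 → S) {a : ℕ} {s : S}
    (hs : s ∈ Ideal.span (uPow t '' {e | a ≤ 2 * e 0 + e 1 + 2 * e 2 + 2 * e 3})) (n : ℕ) :
    s ^ n ∈ Ideal.span (uPow t '' {e | n * a ≤ 2 * e 0 + e 1 + 2 * e 2 + 2 * e 3}) := by
  induction n with
  | zero =>
    rw [pow_zero, zero_mul]
    have : (1 : S) = uPow t 0 := by simp [uPow]
    rw [this]; exact uPow_mem_span_uPow t (by simp)
  | succ n ih =>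
    rw [pow_succ, Nat.succ_mul]
    exact weightIdeal_mul_le t _ _ (Ideal.mul_mem_mul ih hs)

/-- **Base change of the weight filtration**: if the old parameters have the right weights in the new frame (`x, z, w ∈ F₂(t′)`,
`y ∈ F₁(t′)`), then `F_n(t) ≤ F_n(t′)` for every `n`. [folklore] -/
theorem span_uPow_weight_le_of_frame {x y z w : S} (t' : Fin 4 → S)
    (hx : x ∈ Ideal.span (uPow t' '' {e | 2 ≤ 2 * e 0 + e 1 + 2 * e 2 + 2 * e 3}))
    (hy : y ∈ Ideal.span (uPow t' '' {e | 1 ≤ 2 * e 0 + e 1 + 2 * e 2 + 2 * e 3}))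
    (hz : z ∈ Ideal.span (uPow t' '' {e | 2 ≤ 2 * e 0 + e 1 + 2 * e 2 + 2 * e 3}))
    (hw : w ∈ Ideal.span (uPow t' '' {e | 2 ≤ 2 * e 0 + e 1 + 2 * e 2 + 2 * e 3})) (n : ℕ) :
    Ideal.span (uPow ![x, y, z, w] '' {e | n ≤ 2 * e 0 + e 1 + 2 * e 2 + 2 * e 3}) ≤
      Ideal.span (uPow t' '' {e | n ≤ 2 * e 0 + e 1 + 2 * e 2 + 2 * e 3}) := by
  rw [Ideal.span_le]
  rintro _ ⟨e, he, rfl⟩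
  simp only [Set.mem_setOf_eq] at he
  rw [SetLike.mem_coe, uPow_four]
  have h0 := pow_mem_weightIdeal t' hx (e 0)
  have h1 := pow_mem_weightIdeal t' hy (e 1)
  have h2 := pow_mem_weightIdeal t' hz (e 2)
  have h3 := pow_mem_weightIdeal t' hw (e 3)
  have h01 := weightIdeal_mul_le t' _ _ (Ideal.mul_mem_mul h0 h1)
  have h012 := weightIdeal_mul_le t' _ _ (Ideal.mul_mem_mul h01 h2)
  have h0123 := weightIdeal_mul_le t' _ _ (Ideal.mul_mem_mul h012 h3)
  exact weightIdeal_anti t' (by omega) h0123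

/-- The maximal ideal lies in `F₁(t′)`. [folklore] -/
theorem maximalIdeal_le_weightIdeal_one [IsLocalRing S] {x y z' w' : S}
    (hspan' : Ideal.span {x, y, z', w'} = maximalIdeal S) :
    maximalIdeal S ≤ Ideal.span (uPow ![x, y, z', w'] '' {e | 1 ≤ 2 * e 0 + e 1 + 2 * e 2 + 2 * e 3}) := by
  rw [← hspan', ← range_four, Ideal.span_le]
  rintro _ ⟨l, rfl⟩
  rw [SetLike.mem_coe, ← uPow_single ![x, y, z', w'] l]
  refine uPow_mem_span_uPow _ ?_
  fin_cases l <;> simp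

/-- A new parameter of weight two lies in `F₂(t′)`. [folklore] -/
theorem param_mem_weightIdeal_two (x y z' w' : S) {l : Fin 4} (hl : l ≠ 1) :
    ![x, y, z', w'] l ∈ Ideal.span (uPow ![x, y, z', w'] '' {e | 2 ≤ 2 * e 0 + e 1 + 2 * e 2 + 2 * e 3}) := by
  rw [← uPow_single ![x, y, z', w'] l]
  refine uPow_mem_span_uPow _ ?_
  fin_cases l <;> simp at hl ⊢

/-- The weight region is the near-point region. [folklore] -/
theorem weight_iff_nearY (d : ℕ) (e : Fin 4 → ℕ) :
    2 * d ≤ 2 * e 0 + e 1 + 2 * e 2 + 2 * e 3 ↔ (d ≤ e 2 + e 3 ∨ 2 * (d - e 2 - e 3) ≤ 2 * e 0 + e 1) := by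
  omega

/-! ## §2 Purification -/

/-- The `BetaGe (α, β)` exponent condition is up-closed (`α, β ≥ 0`). [folklore] -/
theorem betaRegion_mono {d : ℕ} {α β : ℚ} (hα : 0 ≤ α) (hβ : 0 ≤ β) {b a : Fin 4 → ℕ} (hba : b ≤ a)
    (hb : d ≤ b 2 + b 3 ∨ ⌊α * ((d - b 2 - b 3 : ℕ) : ℚ)⌋₊ + 1 ≤ b 0 ∨
      (⌈α * ((d - b 2 - b 3 : ℕ) : ℚ)⌉₊ ≤ b 0 ∧ ⌈β * ((d - b 2 - b 3 : ℕ) : ℚ)⌉₊ ≤ b 1)) :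
    d ≤ a 2 + a 3 ∨ ⌊α * ((d - a 2 - a 3 : ℕ) : ℚ)⌋₊ + 1 ≤ a 0 ∨
      (⌈α * ((d - a 2 - a 3 : ℕ) : ℚ)⌉₊ ≤ a 0 ∧ ⌈β * ((d - a 2 - a 3 : ℕ) : ℚ)⌉₊ ≤ a 1) := by
  have h0 : b 0 ≤ a 0 := hba 0; have h1 : b 1 ≤ a 1 := hba 1
  have h2 : b 2 ≤ a 2 := hba 2; have h3 : b 3 ≤ a 3 := hba 3
  have hm : d - a 2 - a 3 ≤ d - b 2 - b 3 := by omega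
  rcases hb with hb | hb | ⟨hb0, hb1⟩
  · left; omega
  · right; left; exact le_trans (Nat.add_le_add_right (floor_mul_mono hα hm) 1) (hb.trans h0)
  · right; right; exact ⟨(ceil_mul_mono hα hm).trans (hb0.trans h0), (ceil_mul_mono hβ hm).trans (hb1.trans h1)⟩

/-- **PURIFICATION (J5-a).** `t = (x, y, z, w)` part of a regular system of parameters, characteristic `2`, `α, β ≥ 0`. If `f` lies
in the near-point ideal `F_(2d)` and the cleaning `f + t^ε q²` satisfies `BetaGe (α, β)`, then some cleaning `f + t^ε q′²` satisfies
`BetaGe (α, β)`, lies in `F_(2d)`, and differs from `f + t^ε q²` by a twisted square `t^ε r²`. [cite: CossartPiltant2019, Prop. 2.1] -/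
theorem exists_purified [IsLocalRing S] [CharP S 2] {x y z w : S} (ht : IsRsopPart ![x, y, z, w]) {d : ℕ} {α β : ℚ}
    (hα : 0 ≤ α) (hβ : 0 ≤ β) {f q : S} (ε : Fin 4 → ℕ)
    (hfG : f ∈ Ideal.span (uPow ![x, y, z, w] '' {e | 2 * d ≤ 2 * e 0 + e 1 + 2 * e 2 + 2 * e 3}))
    (hB : BetaGe x y z w d α β (f + uPow ![x, y, z, w] ε * q ^ 2)) :
    ∃ q' r : S, f + uPow ![x, y, z, w] ε * q' ^ 2 ∈
        Ideal.span (uPow ![x, y, z, w] '' {e | 2 * d ≤ 2 * e 0 + e 1 + 2 * e 2 + 2 * e 3}) ∧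
      BetaGe x y z w d α β (f + uPow ![x, y, z, w] ε * q' ^ 2) ∧
      f + uPow ![x, y, z, w] ε * q' ^ 2 = (f + uPow ![x, y, z, w] ε * q ^ 2) + uPow ![x, y, z, w] ε * r ^ 2 := by
  classical
  haveI := ht.isRegularLocalRing
  set t : Fin 4 → S := ![x, y, z, w] with htdef
  have h2 : (2 : S) = 0 := by simpa using CharP.cast_eq_zero S 2
  -- expansion of `q`
  obtain ⟨hQ, hqQ, hminQ⟩ := ht.minExponents_spec q
  obtain ⟨η, hηq⟩ := exists_expansion_minExponents t hqQ
  have hηu := coeff_not_mem_of_minimal _ hQ hminQ hηq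
  set Q := minExponents t q with hQdef
  set P : (Fin 4 → ℕ) → Prop := fun c =>
    2 * d ≤ 2 * (2 • c + ε) 0 + (2 • c + ε) 1 + 2 * (2 • c + ε) 2 + 2 * (2 • c + ε) 3 with hP
  set QG := Q.filter (fun c => P c) with hQG
  set QR := Q.filter (fun c => ¬ P c) with hQR
  set q' : S := ∑ c ∈ QG, η c * uPow t c with hq'
  set r : S := ∑ c ∈ QR, η c * uPow t c with hr
  have hsplit : q = q' + r := by rw [hηq, hq', hr, ← Finset.sum_filter_add_sum_filter_not Q P]
  have hsq : uPow t ε * q' ^ 2 = uPow t ε * q ^ 2 + uPow t ε * r ^ 2 := by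
    rw [hsplit, add_sq]
    linear_combination (-(uPow t ε * q' * r) - uPow t ε * r ^ 2) * h2
  have hsqG : uPow t ε * q' ^ 2 = ∑ c ∈ QG, η c ^ 2 * uPow t (2 • c + ε) := by
    have h := mul_sq_expansion t QG η id ε
    simp only [id] at h
    rw [hq', h]
  have hsqR : uPow t ε * r ^ 2 = ∑ c ∈ QR, η c ^ 2 * uPow t (2 • c + ε) := by
    have h := mul_sq_expansion t QR η id ε
    simp only [id] at h
    rw [hr, h]
  refine ⟨q', r, ?_, ?_, by rw [hsq]; ring⟩
  · -- in the near-point ideal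
    refine add_mem hfG ?_
    rw [hsqG]
    refine Ideal.sum_mem _ fun c hc => Ideal.mul_mem_left _ _ (uPow_mem_span_uPow t ?_)
    exact (Finset.mem_filter.mp hc).2
  · -- `BetaGe (α, β)`: the dropped part lies in the `BetaGe` ideal
    rw [hsq, ← add_assoc]
    -- `u r²` lies in `F_(2d) + B`
    have hD : uPow t ε * r ^ 2 ∈ Ideal.span (uPow t '' ({e | 2 * d ≤ 2 * e 0 + e 1 + 2 * e 2 + 2 * e 3} ∪
        {e | d ≤ e 2 + e 3 ∨ ⌊α * ((d - e 2 - e 3 : ℕ) : ℚ)⌋₊ + 1 ≤ e 0 ∨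
          (⌈α * ((d - e 2 - e 3 : ℕ) : ℚ)⌉₊ ≤ e 0 ∧ ⌈β * ((d - e 2 - e 3 : ℕ) : ℚ)⌉₊ ≤ e 1)})) := by
      have : uPow t ε * r ^ 2 = (f + uPow t ε * q' ^ 2) - (f + uPow t ε * q ^ 2) := by rw [hsq]; ring
      rw [this, Set.image_union, Ideal.span_union]
      refine sub_mem (Ideal.mem_sup_left (add_mem hfG ?_)) (Ideal.mem_sup_right ?_)
      · rw [hsqG]
        refine Ideal.sum_mem _ fun c hc => Ideal.mul_mem_left _ _ (uPow_mem_span_uPow t ?_)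
        exact (Finset.mem_filter.mp hc).2
      · exact mem_of_forall_minExponents_uPow_mem ht fun a ha => uPow_mem_span_uPow t
          ((betaGe_iff_forall_minExponents ht hα hβ _).mp hB a ha)
    -- every term of `u r²` lies in the `BetaGe` region
    rw [hsqR] at hD ⊢
    refine add_mem hB (Ideal.sum_mem _ fun c hc => Ideal.mul_mem_left _ _ ?_)
    refine uPow_mem_betaIdeal x y z w d α β ?_
    -- a minimal element of `QR` below `c`
    obtain ⟨c₀, hc₀c, hc₀min⟩ := (QR.filter (fun c' => c' ≤ c)).exists_le_minimal
      (Finset.mem_filter.mpr ⟨hc, le_rfl⟩)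
    obtain ⟨hc₀R, hc₀le⟩ := Finset.mem_filter.mp hc₀min.prop
    have hηR : ∀ c ∈ QR, η c ∉ Ideal.span (Set.range t) := fun c hc => hηu c (Finset.mem_filter.mp hc).1
    have hmin0 : 2 • c₀ + ε ∈ minExponents t (∑ c ∈ QR, η c ^ 2 * uPow t (2 • c + ε)) := by
      refine two_nsmul_add_mem_minExponents_sum_sq ht QR hηR ε hc₀R fun c' hc' hle => ?_
      exact hc₀min.eq_of_le (Finset.mem_filter.mpr ⟨hc', hle.trans hc₀le⟩) hle
    obtain ⟨g, hg, hgle⟩ := exists_le_of_mem_span_uPow ht hD hmin0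
    have hle : 2 • c₀ + ε ≤ 2 • c + ε := fun l => by
      have h : c₀ l ≤ c l := hc₀le l
      show (2 • c₀ + ε) l ≤ (2 • c + ε) l
      simp only [Pi.add_apply, Pi.smul_apply, smul_eq_mul]; omega
    rcases hg with hg | hg
    · -- `g` in the near-point region: contradicts `c₀ ∈ QR`
      exfalso
      simp only [Set.mem_setOf_eq] at hg
      have hbad := (Finset.mem_filter.mp hc₀R).2
      apply hbad
      have k0 : g 0 ≤ (2 • c₀ + ε) 0 := hgle 0; have k1 : g 1 ≤ (2 • c₀ + ε) 1 := hgle 1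
      have k2 : g 2 ≤ (2 • c₀ + ε) 2 := hgle 2; have k3 : g 3 ≤ (2 • c₀ + ε) 3 := hgle 3
      omega
    · exact betaRegion_mono hα hβ (hgle.trans hle) hg

/-! ## §3 Twisted squares and the cone correction `(x, y)𝔪^(d−1) + 𝔪^(d+1)` -/

/-- A monomial of degree `≥ d` which is not a pure `(z, w)`-monomial of degree `d` lies in `(x, y)𝔪^(d−1) + 𝔪^(d+1)`. [folklore] -/
theorem uPow_mem_coneCorrection [IsLocalRing S] {x y z w : S} (hspan : Ideal.span {x, y, z, w} = maximalIdeal S) {d : ℕ}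
    {e : Fin 4 → ℕ} (he : d + 1 ≤ ∑ l, e l ∨ (d ≤ ∑ l, e l ∧ (1 ≤ e 0 ∨ 1 ≤ e 1))) :
    uPow ![x, y, z, w] e ∈ Ideal.span {x, y} * maximalIdeal S ^ (d - 1) ⊔ maximalIdeal S ^ (d + 1) := by
  have hmem : ∀ e' : Fin 4 → ℕ, uPow ![x, y, z, w] e' ∈ maximalIdeal S ^ (∑ l, e' l) := fun e' => by
    rw [← hspan, span_four_pow_eq_span_uPow]; exact uPow_mem_span_uPow _ (by simp)
  rcases he with he | ⟨hd, h01⟩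
  · exact Ideal.mem_sup_right (Ideal.pow_le_pow_right he (hmem e))
  · refine Ideal.mem_sup_left ?_
    rcases h01 with h0 | h1
    · have hsplit : e = (e - (Pi.single 0 1 : Fin 4 → ℕ)) + Pi.single 0 1 := by
        funext l
        obtain rfl | rfl | rfl | rfl : l = 0 ∨ l = 1 ∨ l = 2 ∨ l = 3 := by fin_cases l <;> simp
        · simp; omega
        all_goals simp
      have hx : (![x, y, z, w] : Fin 4 → S) 0 ∈ Ideal.span ({x, y} : Set S) := Ideal.subset_span (by simp)
      rw [hsplit, uPow_add, uPow_single]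
      refine Ideal.mul_mem_mul_rev hx (Ideal.pow_le_pow_right ?_ (hmem _))
      have : ∑ l, (e - (Pi.single 0 1 : Fin 4 → ℕ)) l = (∑ l, e l) - 1 := by
        rw [sum_four, sum_four]; simp; omega
      rw [this]; omega
    · have hsplit : e = (e - (Pi.single 1 1 : Fin 4 → ℕ)) + Pi.single 1 1 := by
        funext l
        obtain rfl | rfl | rfl | rfl : l = 0 ∨ l = 1 ∨ l = 2 ∨ l = 3 := by fin_cases l <;> simp
        · simp
        · simp; omega
        all_goals simp
      have hy : (![x, y, z, w] : Fin 4 → S) 1 ∈ Ideal.span ({x, y} : Set S) := Ideal.subset_span (by simp)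
      rw [hsplit, uPow_add, uPow_single]
      refine Ideal.mul_mem_mul_rev hy (Ideal.pow_le_pow_right ?_ (hmem _))
      have : ∑ l, (e - (Pi.single 1 1 : Fin 4 → ℕ)) l = (∑ l, e l) - 1 := by
        rw [sum_four, sum_four]; simp; omega
      rw [this]; omega

/-- **A twisted square of order `≥ d` with `(z, w)`-free twist lies in the cone correction `(x, y)𝔪^(d−1) + 𝔪^(d+1)`** when `d` is ODD:
its minimal exponents `2c + ε` have degree `≥ d`, and a pure `(z, w)`-exponent `2c + ε` has even degree. [cite: CossartPiltant2019, Prop. 2.1] -/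
theorem twistedSq_mem_coneCorrection [IsLocalRing S] [CharP S 2] {x y z w : S} (ht : IsRsopPart ![x, y, z, w])
    (hspan : Ideal.span {x, y, z, w} = maximalIdeal S) {d : ℕ} (hodd : Odd d) {ε : Fin 4 → ℕ} (hε2 : ε 2 = 0)
    (hε3 : ε 3 = 0) {r : S} (hr : uPow ![x, y, z, w] ε * r ^ 2 ∈ maximalIdeal S ^ d) :
    uPow ![x, y, z, w] ε * r ^ 2 ∈ Ideal.span {x, y} * maximalIdeal S ^ (d - 1) ⊔ maximalIdeal S ^ (d + 1) := by
  classical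
  obtain ⟨hQ, hrQ, hminQ⟩ := ht.minExponents_spec r
  obtain ⟨η, hηr⟩ := exists_expansion_minExponents ![x, y, z, w] hrQ
  have hηu := coeff_not_mem_of_minimal _ hQ hminQ hηr
  have hexp : uPow ![x, y, z, w] ε * r ^ 2 =
      ∑ c ∈ minExponents ![x, y, z, w] r, η c ^ 2 * uPow ![x, y, z, w] (2 • c + ε) := by
    have h2 := mul_sq_expansion ![x, y, z, w] (minExponents ![x, y, z, w] r) η id ε
    simp only [id] at h2
    rw [← h2, ← hηr]
  refine mem_of_forall_minExponents_uPow_mem ht fun e he => uPow_mem_coneCorrection hspan ?_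
  have hdeg := (mem_pow_iff_forall_minExponents ht hspan d _).mp hr e he
  rw [hexp] at he
  obtain ⟨c, -, rfl⟩ := forall_minExponents_sum_sq ht _ hηu ε _ he
  rw [sum_four] at hdeg ⊢
  simp only [Pi.add_apply, Pi.smul_apply, smul_eq_mul] at hdeg ⊢
  obtain ⟨k, hk⟩ := hodd
  rw [hε2, hε3] at hdeg ⊢
  omega

end Summit.ResolutionOfSingularities.ResolutionOfSingularities.Theorems.SwitchingDichotomy.BetaNewton

end
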